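import Literature.MathematicalPhysics.QuantumFieldTheory.OSReconstructionNoE1
import Literature.Analysis.OperatorTheory.SemigroupJointSpectralMeasure
import HarnessLib

/-!
# Osterwalder–Schrader reconstruction without E1: strong continuity and the joint spectral measure

Discharge of the named fact
`Literature.MathematicalPhysics.QuantumFieldTheory.OSReconstructionNoE1.exists_isJointSpectralMeasure`
of `OSReconstructionNoE1.lean`: for every vector `ψ` of the OS Hilbert space of a labelled Schwinger
family with reflection positivity and translation invariance on `⁰𝒮` there is a finite measure
`μ_ψ` on momentum space, carried by `{p₀ ≥ 0}`, with
`⟪ψ, e^{-tH} U(a⃗) ψ⟫ = ∫ e^{−tp₀ + i⟨a⃗,p⃗⟩} dμ_ψ` (Osterwalder–Schrader 1973, §4.1 p. 92;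
Reed–Simon I Thm. VIII.12).

* **Strong continuity** (OS 1973, (4.10) and p. 92 "weakly continuous … semigroup"; Glimm–Jaffe
  Thm. 6.1.3): `continuous_translate_apply` (`a ↦ U(a⃗) ψ`) and `continuous_transfer_apply`
  (`t ↦ e^{-tH} ψ`, constant for `t ≤ 0` by the junk convention), from the continuity of
  translations on the Schwartz space (`QuantumLattice.continuous_compSubConstCLM`) through the
  weak continuity of the OS form on finite combinations of generators, the isometry/contraction
  property, and density — the road of `OSDistributionSpaceSemigroup` for the one-species tower.
* `isEnergyMomentumPair`: `(e^{-tH}, U)` is an energy–momentum pair in the sense of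
  `Literature.Analysis.OperatorTheory.IsEnergyMomentumPair`, so the abstract theorem
  `IsEnergyMomentumPair.exists_measure_inner_transfer_translate_eq_integral` (Bochner's theorem for
  `e^{ib⁰e^{-H}} U(b)`, functional calculus of `e^{-H}`) yields
  **`exists_isJointSpectralMeasure_holds`**.

## References
* K. Osterwalder, R. Schrader, *Axioms for Euclidean Green's functions*, CMP 31 (1973), §4.1,
  (4.5)–(4.10) and p. 92.
* M. Reed, B. Simon, *Methods of Modern Mathematical Physics I* (rev. ed. 1980), Thm. VIII.12.
* J. Glimm, A. Jaffe, *Quantum Physics* (2nd ed. 1987), Thm. 6.1.3.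
-/

noncomputable section

open Filter ComplexConjugate MeasureTheory
open _root_.Topology
open scoped InnerProductSpace SchwartzMap ComplexOrder
open Literature.MathematicalPhysics.AQFT Literature.MathematicalPhysics.QuantumLattice
open Literature.MathematicalPhysics.QuantumLattice.SchwingerFamily (timeVec timeVec_zero
  appendTensor_translateMulti_eq)
open Literature.Analysis.OperatorTheory

namespace Literature.MathematicalPhysics.QuantumFieldTheory

universe u

namespace OSReconstructionNoE1

variable {ι : Type u} {d : ℕ} [NeZero d]

variable {S : LabelledSchwingerFamily ι (EuclideanSpace ℝ (Fin d))}

/-! ## Weak continuity of translated pairings -/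

omit [NeZero d] in
/-- `b ↦ (0, …, 0, b, …, b)` is continuous. [folklore] -/
theorem continuous_append_zero_const (n m : ℕ) :
    Continuous fun b : EuclideanSpace ℝ (Fin d) =>
      (Fin.append (fun _ : Fin n => (0 : EuclideanSpace ℝ (Fin d))) (fun _ : Fin m => b) :
        Fin (n + m) → EuclideanSpace ℝ (Fin d)) := by
  refine continuous_pi fun i => ?_
  refine Fin.addCases (fun j => ?_) (fun j => ?_) i
  · simp only [Fin.append_left]; exact continuous_const
  · simp only [Fin.append_right]; exact continuous_id

variable (S) in
/-- **Weak continuity of translated pairings**: `b ↦ 𝔖(ΘF_p* ⊗ (F_q)_b)` is continuous on `ℝ^d`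
(translation is continuous on the Schwartz space, `continuous_compSubConstCLM`, and `𝔖ₙ^{k}` is a
continuous functional; Osterwalder–Schrader 1973, (4.10) and p. 92). [cite: OsterwalderSchraderCMP1973, §4.1 eq. (4.10)] -/
theorem continuous_apply_appendTensor_translateMulti (p q : Gen ι d) :
    Continuous fun b : EuclideanSpace ℝ (Fin d) =>
      S (p.deg + q.deg) (Fin.append (p.lab ∘ Fin.rev) q.lab)
        ((osAdjoint p.fn).appendTensor (translateMulti b q.fn)) := by
  simp only [appendTensor_translateMulti_eq]
  exact (S (p.deg + q.deg) (Fin.append (p.lab ∘ Fin.rev) q.lab)).continuous.comp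
    ((QuantumLattice.continuous_compSubConstCLM (𝕜 := ℂ) ((osAdjoint p.fn).appendTensor q.fn)).comp
      (continuous_append_zero_const p.deg q.deg))

variable (S) in
/-- Continuity of `a ↦ 𝔖(ΘF_p* ⊗ (F_q)_{a⃗})` (spatially translated pairings). [folklore] -/
theorem continuous_pairing_spaceShiftGen (p q : Gen ι d) :
    Continuous fun a : EuclideanSpace ℝ (Fin d) => pairing S p (spaceShiftGen a q) := by
  have hsp : Continuous fun a : EuclideanSpace ℝ (Fin d) => spatialPart 0 a := by
    change Continuous fun a : EuclideanSpace ℝ (Fin d) => a - EuclideanSpace.single 0 (a 0)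
    exact continuous_id.sub ((continuous_single_time d).comp (PiLp.continuous_apply 2 _ 0))
  exact (continuous_apply_appendTensor_translateMulti S p q).comp hsp

variable (S) in
/-- The time-translated pairing with the junk convention absorbed: `𝔖(ΘF_p* ⊗ (F_q)_{t ∨ 0})`. [folklore] -/
theorem pairing_timeShiftGen_eq (p q : Gen ι d) (t : ℝ) :
    pairing S p (timeShiftGen t q) = S (p.deg + q.deg) (Fin.append (p.lab ∘ Fin.rev) q.lab)
      ((osAdjoint p.fn).appendTensor (translateMulti (timeVec (max t 0)) q.fn)) := by
  rcases le_or_gt 0 t with ht | ht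
  · rw [timeShiftGen_of_nonneg ht, max_eq_left ht]
    rfl
  · rw [timeShiftGen_of_neg ht, max_eq_right ht.le, timeVec_zero, translateMulti_zero]
    rfl

variable (S) in
/-- Continuity of `t ↦ 𝔖(ΘF_p* ⊗ (F_q)_t)` (time-translated pairings; OS 1973 p. 92: "`{T^t}` is a
weakly continuous one parameter semigroup"). [cite: OsterwalderSchraderCMP1973, §4.1 p. 92] -/
theorem continuous_pairing_timeShiftGen (p q : Gen ι d) :
    Continuous fun t : ℝ => pairing S p (timeShiftGen t q) := by
  simp only [pairing_timeShiftGen_eq]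
  exact (continuous_apply_appendTensor_translateMulti S p q).comp
    ((continuous_single_time d).comp (continuous_id.max continuous_const))

variable (S) in
/-- **Weak continuity of `U(a⃗)` on finite combinations**: `a ↦ (v, U(a⃗) w)` is continuous. [folklore] -/
theorem continuous_osForm_translatePre (v w : Gen ι d →₀ ℂ) :
    Continuous fun a : EuclideanSpace ℝ (Fin d) => osForm S v (translatePre a w) := by
  have h : (fun a : EuclideanSpace ℝ (Fin d) => osForm S v (translatePre a w)) = fun a =>
      ∑ p ∈ v.support, ∑ q ∈ w.support, conj (v p) * w q * pairing S p (spaceShiftGen a q) := by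
    funext a
    rw [translatePre_apply, ← (Finsupp.mapDomain_id : Finsupp.mapDomain id v = v), osForm_mapDomain,
      Finsupp.mapDomain_id]
    rfl
  rw [h]
  exact continuous_finsetSum _ fun p _ => continuous_finsetSum _ fun q _ =>
    continuous_const.mul (continuous_pairing_spaceShiftGen S p q)

variable (S) in
/-- **Weak continuity of `T(t)` on finite combinations**: `t ↦ (v, T(t) w)` is continuous. [folklore] -/
theorem continuous_osForm_transferPre (v w : Gen ι d →₀ ℂ) :
    Continuous fun t : ℝ => osForm S v (transferPre t w) := by
  have h : (fun t : ℝ => osForm S v (transferPre t w)) = fun t =>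
      ∑ p ∈ v.support, ∑ q ∈ w.support, conj (v p) * w q * pairing S p (timeShiftGen t q) := by
    funext t
    rw [transferPre_apply, ← (Finsupp.mapDomain_id : Finsupp.mapDomain id v = v), osForm_mapDomain,
      Finsupp.mapDomain_id]
    rfl
  rw [h]
  exact continuous_finsetSum _ fun p _ => continuous_finsetSum _ fun q _ =>
    continuous_const.mul (continuous_pairing_timeShiftGen S p q)

/-! ## Strong continuity of the spatial translations -/

variable (h : OSReconstructionNoE1 S)

/-- `‖U(a⃗) φ − φ‖² = 2‖φ‖² − 2 Re ⟪φ, U(a⃗) φ⟫` (`U` isometric). [folklore] -/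
theorem norm_translate_sub_sq (a : EuclideanSpace ℝ (Fin d)) (φ : h.Hilbert) :
    ‖h.translate a φ - φ‖ ^ 2 = 2 * ‖φ‖ ^ 2 - 2 * RCLike.re ⟪φ, h.translate a φ⟫_ℂ := by
  rw [@norm_sub_sq ℂ, (h.translate a).norm_map, ← inner_conj_symm, RCLike.conj_re]
  ring

/-- **Strong continuity of `U(a⃗)` at `0` on the dense domain**: `U(a⃗) v(f) → v(f)` as `a → 0`. [folklore] -/
theorem tendsto_translate_vec_nhds_zero (w : Gen ι d →₀ ℂ) :
    Tendsto (fun a : EuclideanSpace ℝ (Fin d) => h.translate a (h.vec w)) (𝓝 0) (𝓝 (h.vec w)) := by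
  have hlim : Tendsto (fun a : EuclideanSpace ℝ (Fin d) => 2 * ‖h.vec w‖ ^ 2 - 2 * RCLike.re ⟪h.vec w, h.translate a (h.vec w)⟫_ℂ)
      (𝓝 0) (𝓝 0) := by
    have hc : Continuous fun a : EuclideanSpace ℝ (Fin d) =>
        2 * ‖h.vec w‖ ^ 2 - 2 * RCLike.re ⟪h.vec w, h.translate a (h.vec w)⟫_ℂ := by
      simp only [translate_vec, inner_vec_vec]
      exact continuous_const.sub (continuous_const.mul
        (RCLike.continuous_re.comp (continuous_osForm_translatePre S w w)))
    have h0 := hc.tendsto 0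
    rw [h.translate_zero_apply, inner_self_eq_norm_sq (𝕜 := ℂ)] at h0
    simpa using h0
  have hsq : Tendsto (fun a : EuclideanSpace ℝ (Fin d) => ‖h.translate a (h.vec w) - h.vec w‖ ^ 2) (𝓝 0) (𝓝 0) := by
    simp only [norm_translate_sub_sq]
    exact hlim
  rw [tendsto_iff_norm_sub_tendsto_zero]
  have := hsq.sqrt
  simpa [Real.sqrt_sq (norm_nonneg _)] using this

/-- **Strong continuity of `U(a⃗)` at `0`**: `U(a⃗) ψ → ψ` as `a → 0` for every `ψ ∈ ℋ` (density and
`‖U(a⃗)‖ = 1`). [cite: OsterwalderSchraderCMP1973, §4.1 eq. (4.10)] -/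
theorem tendsto_translate_nhds_zero (ψ : h.Hilbert) :
    Tendsto (fun a : EuclideanSpace ℝ (Fin d) => h.translate a ψ) (𝓝 0) (𝓝 ψ) := by
  refine Metric.tendsto_nhds.2 fun ε hε => ?_
  obtain ⟨w, hw⟩ := h.denseRange_vec.exists_dist_lt ψ (ε := ε / 3) (by positivity)
  filter_upwards [Metric.tendsto_nhds.1 (h.tendsto_translate_vec_nhds_zero w) (ε / 3) (by positivity)]
    with a ha
  have h1 : dist (h.translate a ψ) (h.translate a (h.vec w)) = dist ψ (h.vec w) := by
    rw [dist_eq_norm, dist_eq_norm, ← map_sub, (h.translate a).norm_map]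
  calc dist (h.translate a ψ) ψ
      ≤ dist (h.translate a ψ) (h.translate a (h.vec w)) +
          dist (h.translate a (h.vec w)) (h.vec w) + dist (h.vec w) ψ := dist_triangle4 _ _ _ _
    _ < ε / 3 + ε / 3 + ε / 3 := by
        gcongr
        · rw [h1]; exact hw
        · rwa [dist_comm]
    _ = ε := by ring

/-- **Strong continuity of the spatial translations**: `a ↦ U(a⃗) ψ` is continuous on `ℝ^d` for
every `ψ ∈ ℋ` (Osterwalder–Schrader 1973, (4.5) with (4.10)). [cite: OsterwalderSchraderCMP1973, §4.1 eq. (4.10)] -/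
theorem continuous_translate_apply (ψ : h.Hilbert) :
    Continuous fun a : EuclideanSpace ℝ (Fin d) => h.translate a ψ := by
  refine continuous_iff_continuousAt.2 fun a₀ => ?_
  rw [ContinuousAt, tendsto_iff_norm_sub_tendsto_zero]
  have hb : ∀ a : EuclideanSpace ℝ (Fin d), ‖h.translate a ψ - h.translate a₀ ψ‖ = ‖h.translate (a - a₀) ψ - ψ‖ := by
    intro a
    conv_lhs => rw [show a = a₀ + (a - a₀) by abel, h.translate_add_apply]
    rw [← map_sub, (h.translate a₀).norm_map]
  simp only [hb]
  have h0 : Tendsto (fun a : EuclideanSpace ℝ (Fin d) => a - a₀) (𝓝 a₀) (𝓝 0) := by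
    simpa using (tendsto_id (x := 𝓝 a₀)).sub_const a₀
  have := (h.tendsto_translate_nhds_zero ψ).comp h0
  rw [tendsto_iff_norm_sub_tendsto_zero] at this
  exact this

/-! ## Strong continuity of the semigroup `e^{-tH}` -/

/-- **Strong continuity of `e^{-tH}` at `0` on the dense domain**: `e^{-tH} v(f) → v(f)` as `t → 0`.
For `t ≥ 0`, `‖T(t)v − v‖² ≤ 2(‖v‖² − Re⟪v, T(t)v⟫)` by the contraction property and symmetry;
for `t < 0`, `T(t) = 1`. [cite: GlimmJaffeQP1987, §6.1 Thm. 6.1.3] -/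
theorem tendsto_transfer_vec_nhds_zero (w : Gen ι d →₀ ℂ) :
    Tendsto (fun t : ℝ => h.transfer t (h.vec w)) (𝓝 0) (𝓝 (h.vec w)) := by
  have hbound : ∀ t : ℝ, ‖h.transfer t (h.vec w) - h.vec w‖ ^ 2 ≤
      2 * (‖h.vec w‖ ^ 2 - RCLike.re ⟪h.vec w, h.transfer t (h.vec w)⟫_ℂ) := by
    intro t
    rcases lt_or_ge t 0 with ht | ht
    · rw [h.transfer_of_neg ht, ContinuousLinearMap.id_apply, sub_self, norm_zero, inner_self_eq_norm_sq]
      simp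
    · rw [@norm_sub_sq ℂ, h.inner_transfer_left]
      have h1 : ‖h.transfer t (h.vec w)‖ ^ 2 ≤ ‖h.vec w‖ ^ 2 :=
        pow_le_pow_left₀ (norm_nonneg _) (h.norm_transfer_le t _) 2
      linarith
  have hlim : Tendsto (fun t : ℝ => 2 * (‖h.vec w‖ ^ 2 - RCLike.re ⟪h.vec w, h.transfer t (h.vec w)⟫_ℂ))
      (𝓝 0) (𝓝 0) := by
    have hc : Continuous fun t : ℝ =>
        2 * (‖h.vec w‖ ^ 2 - RCLike.re ⟪h.vec w, h.transfer t (h.vec w)⟫_ℂ) := by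
      simp only [transfer_vec, inner_vec_vec]
      exact continuous_const.mul (continuous_const.sub
        (RCLike.continuous_re.comp (continuous_osForm_transferPre S w w)))
    have h0 := hc.tendsto 0
    rw [h.transfer_zero, ContinuousLinearMap.id_apply, inner_self_eq_norm_sq (𝕜 := ℂ)] at h0
    simpa using h0
  have hsq : Tendsto (fun t : ℝ => ‖h.transfer t (h.vec w) - h.vec w‖ ^ 2) (𝓝 0) (𝓝 0) :=
    squeeze_zero (fun t => by positivity) hbound hlim
  rw [tendsto_iff_norm_sub_tendsto_zero]
  have := hsq.sqrt
  simpa [Real.sqrt_sq (norm_nonneg _)] using this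

/-- **Strong continuity of `e^{-tH}` at `0`**: `e^{-tH} ψ → ψ` as `t → 0`, for every `ψ ∈ ℋ` (density
and `‖e^{-tH}‖ ≤ 1`). [cite: GlimmJaffeQP1987, §6.1 Thm. 6.1.3] -/
theorem tendsto_transfer_nhds_zero (ψ : h.Hilbert) :
    Tendsto (fun t : ℝ => h.transfer t ψ) (𝓝 0) (𝓝 ψ) := by
  refine Metric.tendsto_nhds.2 fun ε hε => ?_
  obtain ⟨w, hw⟩ := h.denseRange_vec.exists_dist_lt ψ (ε := ε / 3) (by positivity)
  filter_upwards [Metric.tendsto_nhds.1 (h.tendsto_transfer_vec_nhds_zero w) (ε / 3) (by positivity)]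
    with t ht
  have h1 : dist (h.transfer t ψ) (h.transfer t (h.vec w)) ≤ dist ψ (h.vec w) := by
    rw [dist_eq_norm, dist_eq_norm, ← map_sub]
    exact h.norm_transfer_le t _
  calc dist (h.transfer t ψ) ψ
      ≤ dist (h.transfer t ψ) (h.transfer t (h.vec w)) +
          dist (h.transfer t (h.vec w)) (h.vec w) + dist (h.vec w) ψ := dist_triangle4 _ _ _ _
    _ < ε / 3 + ε / 3 + ε / 3 := by
        gcongr
        · exact h1.trans_lt hw
        · rwa [dist_comm]
    _ = ε := by ring

/-- The semigroup estimate `‖e^{-tH}ψ − e^{-sH}ψ‖ ≤ ‖e^{-|t−s|H}ψ − ψ‖` for `s, t ≥ 0`. [folklore] -/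
theorem norm_transfer_sub_transfer_le {s t : ℝ} (hs : 0 ≤ s) (ht : 0 ≤ t) (ψ : h.Hilbert) :
    ‖h.transfer t ψ - h.transfer s ψ‖ ≤ ‖h.transfer |t - s| ψ - ψ‖ := by
  wlog hst : s ≤ t generalizing s t
  · rw [norm_sub_rev, abs_sub_comm]
    exact this ht hs (le_of_not_ge hst)
  rw [abs_of_nonneg (sub_nonneg.2 hst)]
  have h' : h.transfer t ψ = h.transfer s (h.transfer (t - s) ψ) := by
    rw [← ContinuousLinearMap.comp_apply, ← h.transfer_add hs (sub_nonneg.2 hst), add_sub_cancel]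
  rw [h', ← map_sub]
  exact h.norm_transfer_le s _

/-- `e^{-(t ∨ 0)H} = e^{-tH}` (the junk convention in one formula). [folklore] -/
theorem transfer_max (t : ℝ) : h.transfer (max t 0) = h.transfer t := by
  rcases lt_or_ge t 0 with ht | ht
  · rw [max_eq_right ht.le, h.transfer_of_neg ht, h.transfer_zero]
  · rw [max_eq_left ht]

/-- **Strong continuity of the OS semigroup** (Glimm–Jaffe Thm. 6.1.3; Osterwalder–Schrader 1973,
p. 92): for every `ψ ∈ ℋ`, `t ↦ e^{-tH} ψ` is continuous on `ℝ` (constant `= ψ` for `t ≤ 0` by the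
junk convention). [cite: GlimmJaffeQP1987, §6.1 Thm. 6.1.3] -/
theorem continuous_transfer_apply (ψ : h.Hilbert) : Continuous fun t : ℝ => h.transfer t ψ := by
  have hre : (fun t : ℝ => h.transfer t ψ) = fun t => h.transfer (max t 0) ψ := by
    funext t; rw [h.transfer_max]
  rw [hre]
  refine continuous_iff_continuousAt.2 fun t₀ => ?_
  rw [ContinuousAt, tendsto_iff_norm_sub_tendsto_zero]
  have hb : ∀ t : ℝ, ‖h.transfer (max t 0) ψ - h.transfer (max t₀ 0) ψ‖ ≤
      ‖h.transfer |max t 0 - max t₀ 0| ψ - ψ‖ := fun t =>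
    h.norm_transfer_sub_transfer_le (le_max_right _ _) (le_max_right _ _) ψ
  refine squeeze_zero (fun t => norm_nonneg _) hb ?_
  have h0 : Tendsto (fun t : ℝ => |max t 0 - max t₀ 0|) (𝓝 t₀) (𝓝 0) := by
    have hc : Continuous fun t : ℝ => |max t 0 - max t₀ 0| := by fun_prop
    simpa using hc.tendsto t₀
  have := (h.tendsto_transfer_nhds_zero ψ).comp h0
  rw [tendsto_iff_norm_sub_tendsto_zero] at this
  exact this

/-! ## The energy–momentum pair and the joint spectral measure -/

/-- The spatial part of a time-like vector vanishes. [folklore] -/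
theorem spatialPart_single (s : ℝ) : spatialPart 0 (EuclideanSpace.single (0 : Fin d) s) = 0 := by
  ext i
  simp only [spatialPart_apply, PiLp.zero_apply]
  split_ifs with hi
  · rfl
  · simp [hi]

/-- **`(e^{-tH}, U(a⃗))` is an energy–momentum pair**: a strongly continuous semigroup of positive
contractions and a commuting strongly continuous unitary representation of `ℝ^d` trivial on the
time axis (`Literature.Analysis.OperatorTheory.IsEnergyMomentumPair`). [cite: OsterwalderSchraderCMP1973, §4.1 p. 92] -/
theorem isEnergyMomentumPair : IsEnergyMomentumPair h.transfer
    (fun a => ((h.translate a).toContinuousLinearEquiv : h.Hilbert →L[ℂ] h.Hilbert)) where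
  transfer_zero := h.transfer_zero
  transfer_add s t hs ht := h.transfer_add hs ht
  transfer_nonneg t _ := (ContinuousLinearMap.nonneg_iff_isPositive _).2 (h.isPositive_transfer t)
  norm_transfer_le t _ := h.opNorm_transfer_le t
  continuousOn_transfer ψ := (h.continuous_transfer_apply ψ).continuousOn
  translate_zero := ContinuousLinearMap.ext fun ψ => h.translate_zero_apply ψ
  translate_add a b := ContinuousLinearMap.ext fun ψ => h.translate_add_apply a b ψ
  norm_translate a ψ := (h.translate a).norm_map ψ
  continuous_translate ψ := h.continuous_translate_apply ψ
  commute t _ a := ContinuousLinearMap.ext fun ψ => (h.translate_transfer a t ψ).symm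
  translate_single s := ContinuousLinearMap.ext fun ψ => by
    change h.translate (EuclideanSpace.single 0 s) ψ = ψ
    rw [← h.translate_spatialPart, spatialPart_single, h.translate_zero_apply]

/-- **Existence of the joint spectral measure of `(H, P⃗)`** — discharge of the named fact
`exists_isJointSpectralMeasure` (Osterwalder–Schrader 1973, p. 92: `H ≥ 0` self-adjoint with
`T_t = e^{-tH}`, `U(a) = T^{ia⁰} U_s(a⃗)` "a unitary representation of the four dimensional
translation group"; Reed–Simon I Thm. VIII.12): for every vector `ψ` of the OS Hilbert space of a
labelled Schwinger family with E2 and translation invariance on `⁰𝒮` there is a finite measure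
`μ_ψ` on `{p₀ ≥ 0}` with `⟪ψ, e^{-tH} U(a⃗) ψ⟫ = ∫ e^{−tp₀ + i⟨a⃗,p⃗⟩} dμ_ψ`. Proof: the strong
continuity above makes `(e^{-tH}, U)` an energy–momentum pair, and
`IsEnergyMomentumPair.exists_measure_inner_transfer_translate_eq_integral` (Bochner's theorem for the
unitary group `e^{ib⁰e^{-H}} U(b⃗)` and the continuous functional calculus of `e^{-H}`, replacing
Stone–SNAG for the unbounded `H`) gives the measure. [cite: ReedSimonI1980, Thm VIII.12] -/
theorem exists_isJointSpectralMeasure_holds : exists_isJointSpectralMeasure.{u} := by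
  intro ι d _ S h ψ
  obtain ⟨μ, hfin, h0, hint⟩ :=
    h.isEnergyMomentumPair.exists_measure_inner_transfer_translate_eq_integral ψ
  exact ⟨μ, ⟨hfin, h0, fun t ht a ha => by simpa using hint t ht a ha⟩⟩

end OSReconstructionNoE1

end Literature.MathematicalPhysics.QuantumFieldTheory
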